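import Summits.CriticalPhenomena.PercolationContinuityZ3.Theorems.Transplant.FKConnectivityAllQFastEvalBridge
import Summits.CriticalPhenomena.PercolationContinuityZ3.Theorems.Transplant.FKConnectivityAllQForestAdjacentSlice
import Summits.CriticalPhenomena.PercolationContinuityZ3.Theorems.Transplant.FKConnectivityAllQForestAdjacentGuard
import Literature.Probability.Percolation.KozmaNitzanSeparatingTriple
import HarnessLib

/-!
# KERNEL REFUTATIONS of the two CHLW-square nodes: Conjecture R_q (`¬ TwoClusterRayleighGradedPos`) and the adjacent forest
# Rayleigh square (`¬ AdjForestRayleighPos`) both fail on `Fin 10`, at fk-1 g16's 9-vertex, 13-edge graph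

Support file (`--supports stmt-CriticalPhenomena-4575`), FK sub-lane `prim-bschramm-fk-1` (gen 17) of the post-continuity programme;
builds on p205010 (kernel theorem, internal audit signed; external expert review pending).  One listed graph (definition), no named
facts, no sorries; standard axioms (`decide +kernel` on the verified fast evaluator of `…FastEval.lean`; no `native_decide`).

THE WITNESS (fk-1 g16, memo bschramm/FROM-fk-1-g16-FOREST-SLICE.md §1c, evidence CEX-SQUARE-n9.md on stmt-4575; found by kit
j142598 and re-verified by two independent engines).  `H` on `{0,…,8}`,
`E(H) = {23, 67, 24, 45, 36, 15, 58, 07, 17, 46, 08, 04, 12}` (13 = 2·9 − 5 edges: the first level below the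
Cibulka–Hladký–LaCroix–Wagner tree identity), marked vertices `(o, v, y) = (4, 3, 8)`, pinned pairs `e = ov = 43`, `f = oy = 48`, and a
spare isolated vertex `c = 9` (so `V = Fin 10`).  In pattern form the adjacent forest Rayleigh inequality WITH the square,
`N(0,OVY) ≤ N(OV,OY) + N(OY,VY) + N(VY,OV) + N(0,VY)`, fails: `310 > 228 + 28 + 28 + 24 = 308`.  In the GUARDED FIBRE FORM of
`forestGuarded_of_gradedOn` (p309484: Conjecture R_q ⟹ for every fibre avoiding a fresh vertex, `bad + sq ≤ good`) at the fibre
`(M, u₀) = (E(H), ∅)`: `bad = Σ_π N(0,π) = 526`, `sq = N(VY,VY) = 4`, `good = 528`, and `526 + 4 > 528`.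

THE CERTIFICATE.  `…FastEval*.lean` proves that the raw-`Nat` evaluator (`forestB`, `joinedB ∘ compsOf`) decides `IsForestCfg` and
open reachability of the configuration `conf (tOf a)` of a mask `a`, and that a fibre count on `(conf (firstT d), ∅)` is a count of
masks `a < 2^d` (`fibreCount_conf_eq_card`), i.e. a binary-split sum `sumR` (`card_filter_range_eq_sumR`).  Here:
* `bbad / bsq / bgood` — the three indicator Booleans of a mask `a < 2¹³`, read on `conf (tOf a)` and its complement in `E(H)`
  through `isForestCfg_insert_iff` (fk-1 g10) and `KNSep.reachable_insert_iff`: e.g. `ω ∪ {e,f}` is a forest iff `ω` is a forest with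
  `o, v, y` pairwise separated (`isForestCfg_insert_two_iff`);
* `F a = [bbad a] + [bsq a] + (1 − [bgood a])`, so that `Σ_{a<2¹³} F a = bad + sq + (2¹³ − good)` (`sum_F_eq`);
* four kernel evaluations `sumR F 11 (k·2¹¹) = 2098, 2014, 2084, 1998` (`decide +kernel`, ≈ 25 s each), total `8194 = 2¹³ + 2`;
* hence `bad + sq = good + 2` (`guarded_counts`), contradicting `forestGuarded_of_gradedOn` at `c = 9`:
  **`not_twoClusterRayleighGradedOn_fin_ten : ¬ TwoClusterRayleighGradedOn (Fin 10)`** and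
  **`not_twoClusterRayleighGradedPos : ¬ TwoClusterRayleighGradedPos`** (refuted-substantive: the square term of Conjecture R_q is
  not a law below tree level; the square-FREE node `TwoClusterRayleighGradedNoSqPos` (p310496) and Conjecture R at the two-cluster
  level (`TwoClusterRayleighFibrePos`, 0 failures through `n = 10`) are untouched);
* and, through `guarded_of_adjForestRayleighOn` (`…ForestAdjacentGuard.lean`: the node's fibre `(E(H) ∪ {e,f}, ∅)` has the same
  three counts), **`not_adjForestRayleighOn_fin_ten : ¬ AdjForestRayleighOn (Fin 10)`** and
  **`not_adjForestRayleighPos : ¬ AdjForestRayleighPos`** (fk-1 g16's (♣) WITH the square, p309135; refuted-substantive; the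
  square-free node `AdjForestRayleighNoSqPos` — plain coefficientwise forest Rayleigh at an adjacent pair — stands: 0 failures in
  1.2·10¹⁰ exact placements incl. ALL graphs with ≤ 8 vertices, gen 17 kit j143818; nearest print: Huang 2023 Thm. 2.1, adjacent pairs
  of the arboreal gas are negatively correlated for sufficiently large `β`).
MINIMALITY (gen 17, kit j143818, exhaustive): the square-strengthened inequality has NO failure on any connected simple graph with
≤ 8 vertices (63,058,640 graphs on 8 labeled vertices, 1.06·10¹⁰ placements; ≤ 7 vertices: fk-1 g16) nor on multigraphs with ≤ 7
vertices (multiplicity ≤ 3, ≤ 9 edges) — the 9-vertex witness is order-minimal.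
Kernel cost: four `decide +kernel` evaluations of ≈ 15–25 s each; everything else is ordinary proof.
[cite: CibulkaHladkyLaCroixWagner2008, Thm. 1 (p. 2)] [cite: SempleWelsh2008, Conj. 1.1 (p. 2); Thm. 4.2 (p. 11)]
[cite: Grimmett2006, §1.2 eq. (1.1) (p. 4); §1.5 (p. 13)] [cite: Linusson2011, Prop. 2.6] [cite: Huang2023ArborealGas, Thm. 2.1 (p. 2)]
-/

namespace Summit.CriticalPhenomena.PercolationContinuityZ3.Theorems

namespace FK

open Literature.Probability.LatticeModels Literature.Probability.Percolation
open scoped symmDiff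

/-- **The witness graph** `H + e + f` on `Fin 10` (vertex `9` isolated): listed pairs `0..12 = E(H)`, `13 = e = (4,3)`, `14 = f = (4,8)`;
parameters unused (`0`), `q = 1`. (fk-1 g16's counterexample, memo bschramm/FROM-fk-1-g16-FOREST-SLICE.md §1c) -/
abbrev cexD : RCEval where
  n := 10
  m := 15
  src := ![2, 6, 2, 4, 3, 1, 5, 0, 1, 4, 0, 0, 1, 4, 4]
  dst := ![3, 7, 4, 5, 6, 5, 8, 7, 7, 6, 8, 4, 2, 3, 8]
  c := fun _ => 0
  q := 1

namespace ForestSquareCex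

open RCEval

/-! ### The data -/

/-- The data is valid (pairs distinct). [folklore] -/
theorem valid : cexD.Valid := by decide +kernel

/-- No listed loop. [folklore] -/
theorem noloop : ∀ i, cexD.src i ≠ cexD.dst i := by decide +kernel

/-- Listed pair `13` is `e = s(4,3)`. [folklore] -/
theorem edge_thirteen : cexD.edge 13 = s((4 : Fin 10), 3) := by decide +kernel

/-- Listed pair `14` is `f = s(4,8)`. [folklore] -/
theorem edge_fourteen : cexD.edge 14 = s((4 : Fin 10), 8) := by decide +kernel

/-- The fresh vertex `9` meets none of the first 13 listed pairs. [folklore] -/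
theorem nine_notMem_edge : ∀ i : Fin 15, i.val < 13 → (9 : Fin 10) ∉ cexD.edge i := by decide +kernel

/-- The fibre: `M = E(H)`, the configuration of the first 13 listed pairs. [folklore] -/
def M : BondConfig (Fin 10) := cexD.conf (cexD.firstT 13)

/-- `e ∉` any sub-configuration of the first 13 pairs, and likewise `f`. [folklore] -/
theorem e_f_notMem {t : Finset (Fin 15)} (ht : t ⊆ cexD.firstT 13) :
    s((4 : Fin 10), 3) ∉ cexD.conf t ∧ s((4 : Fin 10), 8) ∉ cexD.conf t := by
  rw [← edge_thirteen, ← edge_fourteen, edge_mem_conf valid, edge_mem_conf valid]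
  constructor
  · intro h; have := (mem_firstT 13 _).1 (ht h); simp at this
  · intro h; have := (mem_firstT 13 _).1 (ht h); simp at this

/-! ### Forests with one or two inserted pairs -/

/-- **`ω ∪ {ov, oy}` is a forest iff `ω` is a forest with `o, v, y` pairwise separated** (`o, v, y` distinct, `ov, oy ∉ ω`).
[cite: CibulkaHladkyLaCroixWagner2008, Thm. 1 (p. 2)] [cite: Grimmett2006, §1.5 (p. 13)] -/
theorem isForestCfg_insert_two_iff {V : Type*} {o v y : V} (hov : o ≠ v) (hoy : o ≠ y) (hvy : v ≠ y) {ω : BondConfig V}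
    (he : s(o, v) ∉ ω) (hf : s(o, y) ∉ ω) :
    IsForestCfg (insert s(o, y) (insert s(o, v) ω)) ↔
      IsForestCfg ω ∧ ¬ (openGraph ω).Reachable o v ∧ ¬ (openGraph ω).Reachable o y ∧ ¬ (openGraph ω).Reachable v y := by
  have hf' : s(o, y) ∉ insert s(o, v) ω := by
    rw [Set.mem_insert_iff]; rintro (h | h)
    · exact hvy (Sym2.congr_right.1 h).symm
    · exact hf h
  rw [isForestCfg_insert_iff hoy hf', isForestCfg_insert_iff hov he, KNSep.reachable_insert_iff]
  constructor
  · rintro ⟨⟨hF, hv⟩, h⟩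
    exact ⟨hF, hv, fun h' => h (Or.inl h'), fun h' => h (Or.inr (Or.inl ⟨SimpleGraph.Reachable.refl _, h'⟩))⟩
  · rintro ⟨hF, hv, hy, hvy'⟩
    refine ⟨⟨hF, hv⟩, ?_⟩
    rintro (h | ⟨-, h⟩ | ⟨h, -⟩)
    · exact hy h
    · exact hvy' h
    · exact hv h

/-! ### The indicator Booleans of a mask -/

/-- `o ~ v` in the configuration of the mask `a`. [folklore] -/
def rov (a : ℕ) : Bool := joinedB (cexD.compsOf a) 4 3

/-- `o ~ y` in the configuration of the mask `a`. [folklore] -/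
def roy (a : ℕ) : Bool := joinedB (cexD.compsOf a) 4 8

/-- `v ~ y` in the configuration of the mask `a`. [folklore] -/
def rvy (a : ℕ) : Bool := joinedB (cexD.compsOf a) 3 8

/-- The complementary mask within `E(H)`. [folklore] -/
def cpl (a : ℕ) : ℕ := Nat.xor 8191 a

/-- Indicator of the "bad" pairs: `ω ∪ {e,f}` and `M ∖ ω` forests. [cite: CibulkaHladkyLaCroixWagner2008, Thm. 1 (p. 2)] -/
def bbad (a : ℕ) : Bool := cexD.forestB a && (!rov a && (!roy a && (!rvy a && cexD.forestB (cpl a))))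

/-- Indicator of the "square" pairs: `ω, M ∖ ω ∈ 𝒳⁻`. [cite: CibulkaHladkyLaCroixWagner2008, Thm. 1 (p. 2)] -/
def bsq (a : ℕ) : Bool :=
  (cexD.forestB a && (!rov a && (!roy a && rvy a))) && (cexD.forestB (cpl a) && (!rov (cpl a) && (!roy (cpl a) && rvy (cpl a))))

/-- Indicator of the "good" pairs: `ω ∪ {e}` and `(M ∖ ω) ∪ {f}` forests. [cite: CibulkaHladkyLaCroixWagner2008, Thm. 1 (p. 2)] -/
def bgood (a : ℕ) : Bool := (cexD.forestB a && !rov a) && (cexD.forestB (cpl a) && !roy (cpl a))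

/-- The summand `[bad] + [sq] + (1 − [good])`. [folklore] -/
def F (a : ℕ) : ℕ := cond (bbad a) 1 0 + cond (bsq a) 1 0 + cond (bgood a) 0 1

/-! ### The kernel evaluations -/

/-- First quarter. (this file's `decide +kernel` evaluation) -/
theorem sumR_F_0 : sumR F 11 0 = 2098 := by decide +kernel

/-- Second quarter. (this file's `decide +kernel` evaluation) -/
theorem sumR_F_1 : sumR F 11 2048 = 2014 := by decide +kernel

/-- Third quarter. (this file's `decide +kernel` evaluation) -/
theorem sumR_F_2 : sumR F 11 4096 = 2084 := by decide +kernel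

/-- Fourth quarter. (this file's `decide +kernel` evaluation) -/
theorem sumR_F_3 : sumR F 11 6144 = 1998 := by decide +kernel

/-- **`Σ_{a < 2¹³} F a = 8194`.** (this file's `decide +kernel` evaluation) -/
theorem sumR_F : sumR F 13 0 = 8194 := by
  have h1 : sumR F 13 0 = sumR F 12 0 + sumR F 12 4096 := sumR_split F (by norm_num) (by norm_num)
  have h2 : sumR F 12 0 = sumR F 11 0 + sumR F 11 2048 := sumR_split F (by norm_num) (by norm_num)
  have h3 : sumR F 12 4096 = sumR F 11 4096 + sumR F 11 6144 := sumR_split F (by norm_num) (by norm_num)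
  rw [h1, h2, h3, sumR_F_0, sumR_F_1, sumR_F_2, sumR_F_3]

/-! ### Reading the Booleans on configurations -/

section Reading

variable (a : ℕ)

/-- `forestB` reads `IsForestCfg`. [cite: Grimmett2006, §1.5 (p. 13)] -/
theorem forestB_iff' : cexD.forestB a = true ↔ IsForestCfg (cexD.conf (cexD.tOf a)) := forestB_iff (D := cexD) a valid noloop

/-- `rov` reads `o ~ v`. [folklore] -/
theorem rov_iff : rov a = true ↔ (openGraph (cexD.conf (cexD.tOf a))).Reachable 4 3 := joinedB_iff (D := cexD) a 4 3

/-- `roy` reads `o ~ y`. [folklore] -/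
theorem roy_iff : roy a = true ↔ (openGraph (cexD.conf (cexD.tOf a))).Reachable 4 8 := joinedB_iff (D := cexD) a 4 8

/-- `rvy` reads `v ~ y`. [folklore] -/
theorem rvy_iff : rvy a = true ↔ (openGraph (cexD.conf (cexD.tOf a))).Reachable 3 8 := joinedB_iff (D := cexD) a 3 8

/-- `rov = false` reads `o ≁ v`. [folklore] -/
theorem rov_false_iff : rov a = false ↔ ¬ (openGraph (cexD.conf (cexD.tOf a))).Reachable 4 3 := by
  rw [← Bool.not_eq_true, rov_iff]

/-- `roy = false` reads `o ≁ y`. [folklore] -/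
theorem roy_false_iff : roy a = false ↔ ¬ (openGraph (cexD.conf (cexD.tOf a))).Reachable 4 8 := by
  rw [← Bool.not_eq_true, roy_iff]

/-- `rvy = false` reads `v ≁ y`. [folklore] -/
theorem rvy_false_iff : rvy a = false ↔ ¬ (openGraph (cexD.conf (cexD.tOf a))).Reachable 3 8 := by
  rw [← Bool.not_eq_true, rvy_iff]

/-- The complementary mask is the `xor` with `2¹³ − 1` and opens only the first 13 pairs. [folklore] -/
theorem cpl_eq (ha : a < 2 ^ 13) : Nat.xor (2 ^ 13 - 1) a = cpl a ∧ cexD.tOf (cpl a) ⊆ cexD.firstT 13 := by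
  have h1 : Nat.xor (2 ^ 13 - 1) a = cpl a := by norm_num [cpl]
  refine ⟨h1, ?_⟩
  rw [← h1, tOf_xor 13 a ha]
  exact Finset.sdiff_subset

end Reading

/-! ### The three indicator predicates -/

/-- The "bad" predicate of the guarded inequality is `bbad`. [cite: CibulkaHladkyLaCroixWagner2008, Thm. 1 (p. 2)] -/
theorem bad_iff (a : ℕ) (ha : a < 2 ^ 13) :
    (cexD.conf (cexD.tOf a) ∈ ({ω | s((4 : Fin 10), 3) ∉ ω ∧ s((4 : Fin 10), 8) ∉ ω} ∩
          {ω | insert s((4 : Fin 10), 8) (insert s((4 : Fin 10), 3) ω) ∈ forestEv (Fin 10)}) ∧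
        cexD.conf (cexD.tOf (Nat.xor (2 ^ 13 - 1) a)) ∈ ({ω | s((4 : Fin 10), 3) ∉ ω ∧ s((4 : Fin 10), 8) ∉ ω} ∩ forestEv (Fin 10))) ↔
      bbad a = true := by
  obtain ⟨hc, hB⟩ := cpl_eq a ha
  rw [hc]
  obtain ⟨heA, hfA⟩ := e_f_notMem (tOf_subset_firstT (D := cexD) ha)
  obtain ⟨heB, hfB⟩ := e_f_notMem hB
  have h43 : (4 : Fin 10) ≠ 3 := by decide
  have h48 : (4 : Fin 10) ≠ 8 := by decide
  have h38 : (3 : Fin 10) ≠ 8 := by decide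
  simp only [Set.mem_inter_iff, Set.mem_setOf_eq, forestEv, isForestCfg_insert_two_iff h43 h48 h38 heA hfA, bbad, Bool.and_eq_true,
    Bool.not_eq_true', forestB_iff', rov_false_iff, roy_false_iff, rvy_false_iff]
  tauto

/-- The "square" predicate of the guarded inequality is `bsq`. [cite: CibulkaHladkyLaCroixWagner2008, Thm. 1 (p. 2)] -/
theorem sq_iff (a : ℕ) (ha : a < 2 ^ 13) :
    (cexD.conf (cexD.tOf a) ∈ ({ω | s((4 : Fin 10), 3) ∉ ω ∧ s((4 : Fin 10), 8) ∉ ω} ∩ xMinusEv (4 : Fin 10) 3 8) ∧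
        cexD.conf (cexD.tOf (Nat.xor (2 ^ 13 - 1) a)) ∈ ({ω | s((4 : Fin 10), 3) ∉ ω ∧ s((4 : Fin 10), 8) ∉ ω} ∩ xMinusEv (4 : Fin 10) 3 8)) ↔
      bsq a = true := by
  obtain ⟨hc, hB⟩ := cpl_eq a ha
  rw [hc]
  obtain ⟨heA, hfA⟩ := e_f_notMem (tOf_subset_firstT (D := cexD) ha)
  obtain ⟨heB, hfB⟩ := e_f_notMem hB
  simp only [Set.mem_inter_iff, Set.mem_setOf_eq, xMinusEv, bsq, Bool.and_eq_true, Bool.not_eq_true', forestB_iff', rvy_iff,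
    rov_false_iff, roy_false_iff]
  tauto

/-- The "good" predicate of the guarded inequality is `bgood`. [cite: CibulkaHladkyLaCroixWagner2008, Thm. 1 (p. 2)] -/
theorem good_iff (a : ℕ) (ha : a < 2 ^ 13) :
    (cexD.conf (cexD.tOf a) ∈ ({ω | s((4 : Fin 10), 3) ∉ ω ∧ s((4 : Fin 10), 8) ∉ ω} ∩ {ω | insert s((4 : Fin 10), 3) ω ∈ forestEv (Fin 10)}) ∧
        cexD.conf (cexD.tOf (Nat.xor (2 ^ 13 - 1) a)) ∈
          ({ω | s((4 : Fin 10), 3) ∉ ω ∧ s((4 : Fin 10), 8) ∉ ω} ∩ {ω | insert s((4 : Fin 10), 8) ω ∈ forestEv (Fin 10)})) ↔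
      bgood a = true := by
  obtain ⟨hc, hB⟩ := cpl_eq a ha
  rw [hc]
  obtain ⟨heA, hfA⟩ := e_f_notMem (tOf_subset_firstT (D := cexD) ha)
  obtain ⟨heB, hfB⟩ := e_f_notMem hB
  have h43 : (4 : Fin 10) ≠ 3 := by decide
  have h48 : (4 : Fin 10) ≠ 8 := by decide
  simp only [Set.mem_inter_iff, Set.mem_setOf_eq, forestEv, isForestCfg_insert_iff h43 heA, isForestCfg_insert_iff h48 hfB, bgood,
    Bool.and_eq_true, Bool.not_eq_true', forestB_iff', rov_false_iff, roy_false_iff]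
  tauto

/-- **The guarded counts at the fibre `(E(H), ∅)`: `bad + sq + (2¹³ − good) = 8194`, `good ≤ 2¹³`.**
[cite: Linusson2011, Prop. 2.6] [cite: CibulkaHladkyLaCroixWagner2008, Thm. 1 (p. 2)] -/
theorem guarded_counts :
    fibreCount M ∅ ({ω | s((4 : Fin 10), 3) ∉ ω ∧ s((4 : Fin 10), 8) ∉ ω} ∩
          {ω | insert s((4 : Fin 10), 8) (insert s((4 : Fin 10), 3) ω) ∈ forestEv (Fin 10)})
        ({ω | s((4 : Fin 10), 3) ∉ ω ∧ s((4 : Fin 10), 8) ∉ ω} ∩ forestEv (Fin 10)) +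
      fibreCount M ∅ ({ω | s((4 : Fin 10), 3) ∉ ω ∧ s((4 : Fin 10), 8) ∉ ω} ∩ xMinusEv (4 : Fin 10) 3 8)
        ({ω | s((4 : Fin 10), 3) ∉ ω ∧ s((4 : Fin 10), 8) ∉ ω} ∩ xMinusEv (4 : Fin 10) 3 8) =
      fibreCount M ∅ ({ω | s((4 : Fin 10), 3) ∉ ω ∧ s((4 : Fin 10), 8) ∉ ω} ∩ {ω | insert s((4 : Fin 10), 3) ω ∈ forestEv (Fin 10)})
        ({ω | s((4 : Fin 10), 3) ∉ ω ∧ s((4 : Fin 10), 8) ∉ ω} ∩ {ω | insert s((4 : Fin 10), 8) ω ∈ forestEv (Fin 10)}) + 2 := by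
  have h13 : (13 : ℕ) ≤ cexD.m := by decide
  unfold M
  rw [fibreCount_conf_eq_card_bool valid h13 bbad bad_iff, fibreCount_conf_eq_card_bool valid h13 bsq sq_iff,
    fibreCount_conf_eq_card_bool valid h13 bgood good_iff]
  obtain ⟨h3, hle⟩ := three_counts_eq_sumR 13 bbad bsq bgood
  have hS : sumR (fun a => cond (bbad a) 1 0 + cond (bsq a) 1 0 + cond (bgood a) 0 1) 13 0 = 8194 := sumR_F
  rw [hS] at h3
  generalize ((Finset.range (2 ^ 13)).filter fun a => bbad a = true).card = c₁ at h3 ⊢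
  generalize ((Finset.range (2 ^ 13)).filter fun a => bsq a = true).card = c₂ at h3 ⊢
  generalize ((Finset.range (2 ^ 13)).filter fun a => bgood a = true).card = c₃ at h3 hle ⊢
  have h8192 : (2 : ℕ) ^ 13 = 8192 := by norm_num
  rw [h8192] at h3 hle
  omega

/-- **`¬ TwoClusterRayleighGradedOn (Fin 10)`**: Conjecture R_q with the square fails at the forest slice of the witness graph (via
`forestGuarded_of_gradedOn` at the fresh vertex `c = 9`). [cite: CibulkaHladkyLaCroixWagner2008, Thm. 1 (p. 2)]
[cite: SempleWelsh2008, Conj. 1.1 (p. 2)] -/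
theorem not_twoClusterRayleighGradedOn_fin_ten : ¬ TwoClusterRayleighGradedOn (Fin 10) := by
  intro h
  have hcM : ∀ g ∈ M, (9 : Fin 10) ∉ g := by
    intro g hg
    have hg' : g ∈ (((cexD.firstT 13).image cexD.edge : Finset (Sym2 (Fin 10))) : Set (Sym2 (Fin 10))) := hg
    obtain ⟨i, hi, rfl⟩ := Finset.mem_image.1 (Finset.mem_coe.1 hg')
    exact nine_notMem_edge i ((mem_firstT 13 i).1 hi)
  have key := forestGuarded_of_gradedOn h (M := M) (u₀ := ∅) disjoint_bot_left (o := 4) (v := 3) (y := 8) (c := 9) hcM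
    (fun g hg => hg.elim) (by decide) (by decide) (by decide) (by decide) (by decide) (by decide)
  have := guarded_counts
  omega

/-- **`¬ TwoClusterRayleighGradedPos`** — Conjecture R_q WITH the Cibulka–Hladký–LaCroix–Wagner square term (fk-1 g16, p307622) is
FALSE: it fails on `Fin 10`.  refuted-substantive: witness = fk-1 g16's 9-vertex graph (header); no cheap repair keeps the square
(it fails exactly at the first sub-tree level `|E| = 2|V| − 5`); the square-free node `TwoClusterRayleighGradedNoSqPos` and Conjecture R
(`TwoClusterRayleighFibrePos`) stand. [cite: CibulkaHladkyLaCroixWagner2008, Thm. 1 (p. 2)] [cite: SempleWelsh2008, Conj. 1.1 (p. 2)] -/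
theorem not_twoClusterRayleighGradedPos : ¬ TwoClusterRayleighGradedPos := fun h =>
  not_twoClusterRayleighGradedOn_fin_ten (h 10)

/-- **`¬ AdjForestRayleighOn (Fin 10)`**: the adjacent forest Rayleigh inequality WITH the square fails at the fibre
`(E(H) ∪ {e,f}, ∅)` of the witness graph — its three counts are the guarded counts (`guarded_of_adjForestRayleighOn`).
[cite: CibulkaHladkyLaCroixWagner2008, Thm. 1 (p. 2)] [cite: SempleWelsh2008, Conj. 1.1 (p. 2)] -/
theorem not_adjForestRayleighOn_fin_ten : ¬ AdjForestRayleighOn (Fin 10) := by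
  intro h
  obtain ⟨heM, hfM⟩ := e_f_notMem (t := cexD.firstT 13) subset_rfl
  have key := guarded_of_adjForestRayleighOn h (M := M) (u₀ := ∅) disjoint_bot_left (o := 4) (v := 3) (y := 8) (by decide) heM hfM
    (Set.notMem_empty _) (Set.notMem_empty _)
  have := guarded_counts
  omega

/-- **`¬ AdjForestRayleighPos`** — fk-1 g16's (♣) WITH the Cibulka–Hladký–LaCroix–Wagner square (`N(0,OVY) ≤ N(OV,OY) + N(OY,VY) +
N(VY,OV) + N(0,VY)`, node p309135) is FALSE: it fails on `Fin 10` (pattern counts `310 > 308` on the witness graph).  refuted-substantive;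
the square-free node `AdjForestRayleighNoSqPos` stands. [cite: CibulkaHladkyLaCroixWagner2008, Thm. 1 (p. 2)]
[cite: SempleWelsh2008, Conj. 1.1 (p. 2); Thm. 4.2 (p. 11)] -/
theorem not_adjForestRayleighPos : ¬ AdjForestRayleighPos := fun h => not_adjForestRayleighOn_fin_ten (h 10)

end ForestSquareCex

end FK

end Summit.CriticalPhenomena.PercolationContinuityZ3.Theorems
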